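import Summits.QuantumFields.YangMills.Theorems.PoincareLipschitzIteratedOfAvgStabilityModGauge
import Summits.QuantumFields.YangMills.Theses.PoincareLipschitz
import HarnessLib

/-!
# Route crux `PoincareLipschitz.BlockLipschitzL` (stmt-QuantumFields-23533) BY NAME from ONE displayed row
# «stability of the `(j−1)`-fold Bałaban average modulo level-`(j−1)` gauge» — the by-name layer of the K2-TOP door

`BlockLipschitzL` (the deterministic link-Lipschitz bound `CL/√(L^j)` for the height-`j` averaged plaquette deviation on locally hierarchically
small pairs, all `1 ≤ j`, `j + 2 ≤ K`) splits by depth exactly as in the registered skeleton `Cruxes/HistoryTailL/Lines/poincare_lipschitz.lean`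
(`BlockLipschitzL_of`): the `j = 1` rung is IN THE TREE (✓ `PoincareLipschitzLevelOneLipschitz.stub_levelOneLipschitz`, w5 g9), and the `j ≥ 2`
rung is the K2-TOP door ✓ `PoincareLipschitzIteratedOfAvgStability.stub_iteratedLipschitz_of_avgStabilityModGauge` (w1 g7) from the displayed
row.  This file composes the two BY NAME: `blockLipschitzL_of_avgStabilityModGauge (hStab) : Theses.PoincareLipschitz.BlockLipschitzL`.

So the ledger item stmt-QuantumFields-23533 is REDUCED BY KERNEL to the single displayed row `hStab` (for each `L` a constant `CS` such that for
hierarchically small pairs SOME level-`j` gauge copy of `Ū^j(U')` is within `CS/√(L^{j+1})·(box ℓ² link distance)` of `Ū^j(U)` in `dist1` on the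
two-block footprints of `∂a`).  The row is NOT proved here; its honest content is Bałaban's averaging regularity modulo gauge
([Balaban1985Averaging] Props 1–3; linear model = ✓ `PoincareLipschitzLinAvgEll2.abs_curlAt_linAvgIter_le_sqrt`), and its un-quotiented
form (no `∃ h`) is false (gauge witness recorded in the door file's header).

WHAT THIS IS NOT: no proof of `BlockLipschitzL`, of the crux `HistoryTailL` (stmt-QuantumFields-19936), of rung R3 (YM₃ on T³ — not d = 4, not
infinite volume, not a mass gap, not the Clay problem) or of a summit statement.  Width seat ym-ust-19936-w1 g7 (cell ym3-torus).
-/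

noncomputable section

namespace Summit.QuantumFields.YangMills.Theorems.PoincareLipschitzBlockLipschitzOfAvgStability

open Literature.MathematicalPhysics.QuantumFieldTheory.Balaban1983to89
open Literature.MathematicalPhysics.QuantumFieldTheory.Balaban1983to89.T3ContinuumYM3Torus
open Summit.QuantumFields.YangMills.Theorems.PoincareLipschitzLevelOneLipschitz (stub_levelOneLipschitz)
open Summit.QuantumFields.YangMills.Theorems.PoincareLipschitzIteratedOfAvgStability (stub_iteratedLipschitz_of_avgStabilityModGauge)

/-- ★ **`BlockLipschitzL` ⟸ AVERAGE STABILITY MODULO GAUGE** (stmt-QuantumFields-23533 by name, modulo one displayed row): the `j = 1` rung is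
✓`stub_levelOneLipschitz`, the `j ≥ 2` rung is the K2-TOP door fed with `hStab`; the two depth ranges are merged with `CL := max CL₁ CL₂` and
`γ₁ := min γ₁ γ₂` exactly as in the registered skeleton's `BlockLipschitzL_of`. [cite: Balaban1987RG1, (0.4) p.253; Balaban1985Averaging, (11) p.19] -/
theorem blockLipschitzL_of_avgStabilityModGauge
    (hStab : open Literature.MathematicalPhysics.QuantumFieldTheory.Balaban1983to89 Literature.MathematicalPhysics.QuantumFieldTheory.Balaban1983to89.T3ContinuumYM3Torus in ∀ (L : ℕ), ∃ CS : ℝ, 0 ≤ CS ∧ ∀ (b₀ p₀ : ℝ), 0 < b₀ → 2 < p₀ → ∃ γ₁ : ℝ, 0 < γ₁ ∧ γ₁ ≤ 1 ∧ ∀ (F : T3Family) (γ : ℝ), F.L = L → 0 < γ → γ ≤ γ₁ → ∀ (K j : ℕ), 1 ≤ j → j + 3 ≤ K → ∀ (a : Plaq (F.P K) (j + 1)) (U U' : GaugeField (F.P K) 0 (Matrix.specialUnitaryGroup (Fin 2) ℂ)), (∀ (i : ℕ) (q : Plaq (F.P K) i), i < j + 1 → Site.tdist (fun k => ((((q.src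 k).val * F.L ^ i : ℕ)) : ZMod ((F.P K).sitesPerDir 0))) (fun k => ((((a.src k).val * F.L ^ (j + 1) : ℕ)) : ZMod ((F.P K).sitesPerDir 0))) + 64 * F.L ^ i ≤ 64 * F.L ^ (j + 1) → GaugeGroup.dist1 (GaugeField.plaqHol (Averaging.iter (fun i' => BlockAveraging.blockAvg (P := F.P K) (j := i') T3UnitLawDensityEML.ℰp) i U) q) < T3UnitScaleTilt.θBal F.L γ b₀ p₀ (K - i)) → (∀ (i : ℕ) (q : Plaq (F.P K) i), i < j + 1 → Site.tdist (fun k => ((((q.src k).val * F.L ^ i : ℕ)) : ZMod ((F.P K).sitesPerDir 0))) (fun k => ((((a.src k).val * F.L ^ (j + 1) : ℕ)) : ZMod ((F.P K).sitesPerDir 0))) + 64 * F.L ^ i ≤ 64 * F.L ^ (j + 1) → GaugeGroup.dist1 (GaugeField.plaqHol (Averaging.iter (fun i' => BlockAveraging.blockAvg (P := F.P K) (j := i') T3UnitLawDensityEML.ℰp) i U') q) < T3UnitScaleTilt.θBal F.L γ b₀ p₀ (K - i)) → ∃ h : GaugeTransf (F.P K) j (Matrix.specialUnitaryGroup (Fin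 2) ℂ), ∀ c : PBond (F.P K) (j + 1), (c = ⟨a.src, a.μ⟩ ∨ c = ⟨a.src.shift a.μ, a.ν⟩ ∨ c = ⟨a.src.shift a.ν, a.μ⟩ ∨ c = ⟨a.src, a.ν⟩) → ∀ b : PBond (F.P K) j, (blockOf b.src = c.src ∨ blockOf b.src = c.tgt) → (blockOf b.tgt = c.src ∨ blockOf b.tgt = c.tgt) → GaugeGroup.dist1 (Averaging.iter (fun i' => BlockAveraging.blockAvg (P := F.P K) (j := i') T3UnitLawDensityEML.ℰp) j U b * (GaugeField.gaugeAct h (Averaging.iter (fun i' => BlockAveraging.blockAvg (P := F.P K) (j := i') T3UnitLawDensityEML.ℰp) j U') b)⁻¹) ≤ CS / Real.sqrt ((F.L : ℝ) ^ (j + 1)) * Real.sqrt (∑ b : PBond (F.P K) 0, if (∀ k, (b.src k - ((((a.src k).val * F.L ^ (j + 1) : ℕ)) : ZMod ((F.P K).sitesPerDir 0)) + ((8 * F.L ^ (j + 1) : ℕ) : ZMod ((F.P K).sitesPerDir 0))).val < 17 * F.L ^ (j + 1)) ∧ (∀ k, (b.tgt k - ((((a.src k).val * F.L ^ (j + 1)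 : ℕ)) : ZMod ((F.P K).sitesPerDir 0)) + ((8 * F.L ^ (j + 1) : ℕ) : ZMod ((F.P K).sitesPerDir 0))).val < 17 * F.L ^ (j + 1)) then GaugeGroup.dist1 (U b * (U' b)⁻¹) ^ 2 else 0)) :
    Summit.QuantumFields.YangMills.Theses.PoincareLipschitz.BlockLipschitzL := by
  have hA := stub_levelOneLipschitz
  have hB := stub_iteratedLipschitz_of_avgStabilityModGauge hStab
  intro L
  obtain ⟨C1, hC1, HA⟩ := hA L
  obtain ⟨C2, hC2, HB⟩ := hB L
  refine ⟨max C1 C2, le_max_of_le_left hC1, ?_⟩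
  intro b₀ p₀ hb hp
  obtain ⟨γa, hγa, hγa1, HA'⟩ := HA b₀ p₀ hb hp
  obtain ⟨γb, hγb, hγb1, HB'⟩ := HB b₀ p₀ hb hp
  refine ⟨min γa γb, lt_min hγa hγb, (min_le_left _ _).trans hγa1, ?_⟩
  intro F γ hFL hγ hγ1 K j hj hjK a U U' hU hU'
  by_cases hcase : j ≤ 1
  · have h := HA' F γ hFL hγ (hγ1.trans (min_le_left γa γb)) K j hj hjK hcase a U U' hU hU'
    refine h.trans (mul_le_mul_of_nonneg_right ?_ (Real.sqrt_nonneg _))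
    exact div_le_div_of_nonneg_right (le_max_left _ _) (Real.sqrt_nonneg _)
  · have h := HB' F γ hFL hγ (hγ1.trans (min_le_right γa γb)) K j hj hjK (by omega) a U U' hU hU'
    refine h.trans (mul_le_mul_of_nonneg_right ?_ (Real.sqrt_nonneg _))
    exact div_le_div_of_nonneg_right (le_max_right _ _) (Real.sqrt_nonneg _)

end Summit.QuantumFields.YangMills.Theorems.PoincareLipschitzBlockLipschitzOfAvgStability
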